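import Literature.MathematicalPhysics.QuantumFieldTheory.Balaban1983to89.B9Eq3133H1kPiTwoBackgroundLetterTower
import Literature.MathematicalPhysics.QuantumFieldTheory.Balaban1983to89.B9Eq3133H1kPiTwoBackgroundGradientLetterTower

/-!
# `Balaban1983to89.B9Eq3133H1kPiTwoBackgroundSupRowsTower` — T. Bałaban, *Propagators for lattice gauge theories in a background field*, Commun. Math. Phys. **99** (1985) 389–434
# [Balaban1985BackgroundPropagators] (3.126) p. 420, (3.122) p. 420, (3.131)–(3.133) p. 422, Thm 3.4 p. 400, (3.47) p. 398, with [Balaban1985Variational] (45) p. 285, (103) p. 293, (117)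
# p. 295: **THE TWO-BACKGROUND LADDER OF PRINT's MINIMIZER `H̃_k` AT THE FLAT BASE, GLOBAL FORM — the two LATTICE-FREE sup rows `‖((H̃_k(U) − H_k(1))z)(b)‖ ≤ (j₀ + α)·K·‖z‖_∞` and
# `‖(∇_1(H̃_k(U) − H_k(1))z)(b, μ)‖ ≤ (j₀ + α)·K·‖z‖_∞`, constants BEFORE `n, η, m, U`** — the block decomposition of the source over the coarse base points applied to gen 101's local
# letters `B9Eq3133H1kPiTwoBackgroundLetterTower` (value) and `B9Eq3133H1kPiTwoBackgroundGradientLetterTower` (flat gradient); the `(hT, hDT)` pair the OWNER's socket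
# `B11Eq117ReadLettersBridge.norm_H1CLM_le_of_global` consumes for `H₁ := H̃_k(U) − H_k(1)` read at `∇_1` — the π-twin of gen 101's `B9Eq3126H1kTwoBackgroundSupRowsTower`, i.e. the rows
# of the chart actually instantiated by the cell's `Support/NE9CurChartTowerPi…` leaves (`H̃_k(1) = H_k(1)`: `B9Eq3119DeltaPiTowerFlat`)

statement-level skeleton of published theorems with citation tags; proofs where landed; nothing here is a claim about the Yang–Mills mass gap

CITATION HEADER (lean-in-tree rule).  Audit cell `pub-balaban`, sub-cell `t4`, BINDER row NE9; filed by NE9 crux-team LEAF PROVER 01 (`b2b-balaban-t4-ne9-formalise-leaf-01`, gen 101;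
ROUTE (J′), π-side; bears_on: R4/N22).  Composition BY NAME: this lineage's gen-101 `B9Eq3133H1kPiTwoBackgroundLetterTower.exists_letter_H1kPi_sub_flat` (value letter) and
`B9Eq3133H1kPiTwoBackgroundGradientLetterTower.exists_gradLetter_H1kPi_sub_flat` (flat-gradient letter); ne9-leaf-01's `B9Eq349BlockMultipliers.{exists_block_clm_family, sum_block_apply}`;
`B4Sect5Torus.torusSum_le`.  Source READ first-hand in the held text layer `paper:balaban1985-cmp99-background-propagators` (journal page = PDF page + 388) pp. 398, 400, 420–422.  NOTHING of
print's proofs is reproduced: [folklore] block decomposition + row sums (the text of `B9Eq3126H1kTwoBackgroundSupRowsTower` with the π suppliers).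

WHAT IS PROVED (sorry-free; proof lane — 0 `def`; [folklore]).
* **`exists_supRows_H1kPi_sub_flat`** — `∃ α₁ j₁ > 0, K ≥ 0` BEFORE the binder block of `exists_letter_H1kPi_sub_flat` (without its source binders); conclusion: the conjunction of the two
  global rows above, for EVERY coarse-bond field `z` with `‖z(c′)‖ ≤ M` (`0 ≤ M`), `H̃_k(U) = H1LatticeK hposπ hQ`, `H_k(1) = H1k … 1 … hpos₁`.
HONEST SCOPE.  Composition BY NAME on the cell's MODEL rows (O-NE9-1, #5 UNRULED); constants crude; `j₀` and `α` displayed separately; the windows, `c₀ = η^d`, unitarity, the tower data,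
`hαL`, the positivity and onto witnesses stay HYPOTHESES; nothing of [B9] (3.130)–(3.133) ∕ Thm 3.4 or [B11] (117) asserted as printed; «NE9 ⇐ the named binders»; NE9 NOT PRINTED ∕ NOT PROVED;
spine PROVED 0∕9; rung (B)+1 on a finite T⁴ — NOT infinite volume, NOT mass gap, NOT BetaPertH, NOT Clay.  HONEST DEPENDENCY: continuum YM on T⁴ ⇐ BetaPertH ∧ nine spine estimates (0/9
proved); BetaPertH ⇐ (D1) ∧ (D4) ∧ CAP+tail; G-an2-4 gates asym, D1 and NE2/3/4.  NEW file; nothing modified.  Net new unproved facts: 0.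
-/

noncomputable section

open scoped InnerProductSpace ComplexConjugate BigOperators

namespace Literature.MathematicalPhysics.QuantumFieldTheory.Balaban1983to89.B9Eq3133H1kPiTwoBackgroundSupRowsTower

open B4Sect5Torus (TSite tdist tdist_nonneg torusSum_le)
open B4Sect5Proof (latticeConst latticeConst_nonneg)
open B9SectCLatticeCarrier (Bond bpos btgt shift unshift)
open B9Eq311L2Pairing (WL2)
open B9Eq319QprimeTorus (blockCoord)
open B7Prop1Explicit (U1 Wcx boxVec)
open B11Eq103H1Complex (SiteL2K BondL2K)
open B9Eq33CovDerivVector (covGrad)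
open B9Eq310DeltaPrime (plaqHolU)
open B9Eq310HessianOperator (adTransportW)
open B9Eq315QTorus (perCfg cornerSite)
open B9Eq315QTower (towerP UlevOf)
open B9Eq315QTowerFlat (perCfg_UlevOf_one_mem_U1 norm_Wcx_UlevOf_one_sub_one_le)
open B9Eq316TowerFlatIsOneStep (towerP_eq_fineP_pow siteCast)
open B9Eq326OperatorTower (laplaceAk H1k)
open B9Eq324DeltaPrimeATower (laplacePrimeAk)
open B9Eq349BlockMultipliers (exists_block_clm_family sum_block_apply)
open B11Eq103H1Complex (H1LatticeK)
open B9Eq3119DeltaPiTower (laplaceAkPi)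
open B9Eq326OperatorTower (QkW)
open B9Eq3133H1kPiTwoBackgroundLetterTower (exists_letter_H1kPi_sub_flat)
open B9Eq3133H1kPiTwoBackgroundGradientLetterTower (exists_gradLetter_H1kPi_sub_flat)

variable {d : ℕ} (hd : 1 ≤ d) (L : ℕ) [NeZero L] (hL : 1 ≤ L) (hL3 : 3 ≤ L)
  {𝔸 : Type*} [NormedRing 𝔸] [NormedAlgebra ℂ 𝔸] [CompleteSpace 𝔸] [NormOneClass 𝔸] [StarRing 𝔸] [NormedStarGroup 𝔸] [StarModule ℂ 𝔸] [FiniteDimensional ℂ 𝔸]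
  {W : Type*} [NormedAddCommGroup W] [InnerProductSpace ℂ W] [FiniteDimensional ℂ W] (φ : W ≃ₗ[ℂ] 𝔸)
  {Mφ Mφ' : ℝ} (hMφ : 0 ≤ Mφ) (hMφ' : 0 ≤ Mφ') (hφ : ∀ w, ‖φ w‖ ≤ Mφ * ‖w‖) (hφ' : ∀ X, ‖φ.symm X‖ ≤ Mφ' * ‖X‖) (hstar : ∀ X : 𝔸, ‖star X‖ ≤ ‖X‖)
  {a : ℝ} (ha : 0 < a) {a' : ℝ} (ha' : 0 < a') {ϱ : ℝ} (hϱ0 : 0 ≤ ϱ) (hϱ1 : ϱ < 1)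
  (τ : 𝔸 →ₗ[ℂ] ℂ) {Cτ : ℝ} (hτ : ∀ X, ‖τ X‖ ≤ Cτ * ‖X‖) (hCτ : 0 ≤ Cτ) {Mτ : ℝ} (hτm : ∀ X Y : 𝔸, ‖τ (X * Y)‖ ≤ Mτ * ‖X‖ * ‖Y‖) (hMτ : 0 ≤ Mτ)
  {ρw : ℝ} (hρw : 0 ≤ ρw)
  (hτ₁ : ∀ X : 𝔸, τ (star X) = conj (τ X)) (hτ₂ : ∀ X Y : 𝔸, τ (X * Y) = τ (Y * X)) (hφτ : ∀ X Y : 𝔸, ⟪φ.symm X, φ.symm Y⟫_ℂ = τ (star X * Y))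
  (AQ : ℝ)
  {ι : Type} [Fintype ι] [DecidableEq ι] (b : Module.Basis ι ℝ 𝔸) {M₂ : ℝ} (hM₂ : 0 ≤ M₂) (hrepr : ∀ (v : 𝔸) (i : ι), |b.repr v i| ≤ M₂ * ‖v‖)

/-! ## The global sup rows of `H̃_k(U) − H_k(1)` (value and flat gradient), lattice-free -/

include hd hL hL3 hMφ hMφ' hφ hφ' hstar ha ha' hϱ0 hϱ1 hτ hCτ hτm hMτ hρw hτ₁ hτ₂ hφτ hM₂ hrepr in
set_option maxHeartbeats 3200000 in
set_option maxRecDepth 8192 in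
/-- **THE TWO-BACKGROUND LADDER OF PRINT's `H̃_k`, GLOBAL FORM** — see the module docstring: for every coarse-bond field `z` with `‖z(c′)‖ ≤ M`,
`‖((H̃_k(U) − H_k(1))z)(b)‖ ≤ (j₀ + α)·K·M` and `‖(∇_1(H̃_k(U) − H_k(1))z)(b, μ)‖ ≤ (j₀ + α)·K·M`, constants before the lattice. [folklore]
[cite: Balaban1985BackgroundPropagators, (3.126) p.420, (3.122) p.420, (3.131)–(3.133) p.422, Thm 3.4 p.400, (3.47) p.398; Balaban1985Variational, (45) p.285, (103) p.293, (117) p.295] -/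
theorem exists_supRows_H1kPi_sub_flat :
    ∃ α₁ j₁ K : ℝ, 0 < α₁ ∧ 0 < j₁ ∧ 0 ≤ K ∧
      ∀ (n : ℕ) (η : ℝ) (_hηL : η * (L : ℝ) ^ (n + 1) = 1) (c₀ c₁ : ℝ) [Fact (0 < c₀)] [Fact (0 < c₁)]
        (_hw : c₀ * ((L : ℝ) ^ (n + 1)) ^ d = c₁) (_hρ : |η| ^ d / c₀ ≤ ρw) (m : Fin d → ℕ) [∀ i, NeZero (m i)] (_hm : ∀ i, 1 ≤ m i)
        (U : Bond d (towerP L m (n + 1)) → 𝔸ˣ) (αU : ℕ → ℝ) (_hα0 : ∀ j, 0 ≤ αU j) (hα1 : ∀ j, αU j ≤ 1 / 64)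
        (hαL : ∀ j, 50 * (d + 1) * αU j * (L : ℝ) ^ d ≤ 1 / 2)
        (hU1 : ∀ (j : ℕ) (x : B7Prop1Explicit.Site d) (k : Fin d), perCfg (towerP L m (j + 1)) (UlevOf L m (n + 1) U j) x k ∈ U1 𝔸)
        (hreg : ∀ (j : ℕ) (y : TSite d (towerP L m j)) (k : Fin d) (ρ' : Fin d → Fin L),
          ‖((Wcx L (perCfg (towerP L m (j + 1)) (UlevOf L m (n + 1) U j)) (cornerSite L y) k (boxVec L ρ') : 𝔸ˣ) : 𝔸) - 1‖ ≤ αU j)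
        (εU : ℕ → ℝ) (_hεU : ∀ j, 0 ≤ εU j) (_hε1 : ∀ j, εU j ≤ 1) (_hUε : ∀ (j : ℕ) (b : Bond d (towerP L m (j + 1))), ‖(UlevOf L m (n + 1) U j b : 𝔸) - 1‖ ≤ εU j)
        (_hLb : ∀ (j : ℕ) (b : Bond d (towerP L m (j + 1))), UlevOf L m (n + 1) U j b ∈ U1 𝔸)
        (α : ℝ) (_hα : 0 ≤ α) (_hαle : α ≤ α₁)
        (hUst : ∀ b, star (U b : 𝔸) = (((U b)⁻¹ : 𝔸ˣ) : 𝔸)) (_hUb : ∀ b, U b ∈ U1 𝔸) (_hUη : ∀ b, ‖(U b : 𝔸) - 1‖ ≤ α * η)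
        (_hUw : ∀ (x : TSite d (towerP L m (n + 1))) (μ ν : Fin d), ‖(U (shift ν x, μ) : 𝔸) - (U (x, μ) : 𝔸)‖ ≤ α * η ^ 2)
        (_hpl : ∀ p : B9SectCLatticeCarrier.Plaq d (towerP L m (n + 1)), ‖(plaqHolU U p : 𝔸) - 1‖ ≤ α * η ^ 2)
        (_hUgrad : ∀ (x : TSite d (towerP L m (n + 1))) (μ : Fin d), ‖(U (x, μ) : 𝔸) - U (unshift μ x, μ)‖ ≤ α * η ^ 2)
        (_hRlev : ∀ (j : ℕ) (b : Bond d (towerP L m (j + 1))) (w : W), ‖adTransportW φ (UlevOf L m (n + 1) U j) b w‖ ≤ ‖w‖)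
        (_hεg : ∀ j < n + 1, εU j ≤ α * ϱ ^ j) (_hAQ : ∑ j ∈ Finset.range (n + 1), αU j ≤ AQ)
        (hpos' : ∀ x : SiteL2K ℂ d (towerP L m (n + 1)) c₀ W, x ≠ 0 → 0 < RCLike.re ⟪x, laplacePrimeAk L m n φ η U a' (c₁ := c₁) x⟫_ℂ)
        (hpos : ∀ x : BondL2K ℂ d (towerP L m (n + 1)) c₀ W, x ≠ 0 →
          0 < RCLike.re ⟪x, laplaceAk L m n φ η U hL αU hα1 hU1 hreg τ (c₀ := c₀) (c₁ := c₁) a x⟫_ℂ)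
        (_hc₀η : c₀ = η ^ d) (j₀ : ℝ) (_hJ : ∀ μ y, ‖B9Eq39Adjoint.J (fun μ => B9Eq33CovDerivVector.shiftEquiv μ) (fun μ y => U (y, μ)) η μ y‖ ≤ j₀) (_hj : j₀ ≤ j₁)
        (hposπ : ∀ x : BondL2K ℂ d (towerP L m (n + 1)) c₀ W, x ≠ 0 →
          0 < RCLike.re ⟪x, laplaceAkPi L m n φ τ η U a' hpos' hL αU hα1 hU1 hreg (c₁ := c₁) a x⟫_ℂ)
        (hQ : Function.Surjective (QkW L m n φ U hL αU hα1 hU1 hreg (c₀ := c₀) (c₁ := c₁)))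
        (hpos'₁ : ∀ x : SiteL2K ℂ d (towerP L m (n + 1)) c₀ W, x ≠ 0 →
          0 < RCLike.re ⟪x, laplacePrimeAk L m n φ η (fun _ : Bond d (towerP L m (n + 1)) => (1 : 𝔸ˣ)) a' (c₁ := c₁) x⟫_ℂ)
        (hpos₁ : ∀ x : BondL2K ℂ d (towerP L m (n + 1)) c₀ W, x ≠ 0 →
          0 < RCLike.re ⟪x, laplaceAk L m n φ η (fun _ : Bond d (towerP L m (n + 1)) => (1 : 𝔸ˣ)) hL (fun _ => 0) (fun _ => by norm_num)
            (perCfg_UlevOf_one_mem_U1 L m (n + 1)) (norm_Wcx_UlevOf_one_sub_one_le L m (n + 1) (fun _ => 0) (fun _ => le_rfl)) τ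
            (c₀ := c₀) (c₁ := c₁) a x⟫_ℂ),
      (∀ (z : BondL2K ℂ d m c₁ W) (M : ℝ), 0 ≤ M → (∀ c', ‖WL2.equiv ℂ (fun _ : Bond d m => c₁) W z c'‖ ≤ M) →
        ∀ bd : Bond d (towerP L m (n + 1)),
          ‖WL2.equiv ℂ (fun _ : Bond d (towerP L m (n + 1)) => c₀) W
              ((H1LatticeK hposπ hQ -
                H1k L m n φ η (fun _ : Bond d (towerP L m (n + 1)) => (1 : 𝔸ˣ)) hL (fun _ => 0) (fun _ => by norm_num)
                (perCfg_UlevOf_one_mem_U1 L m (n + 1)) (norm_Wcx_UlevOf_one_sub_one_le L m (n + 1) (fun _ => 0) (fun _ => le_rfl)) τ (c₀ := c₀) (c₁ := c₁)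
                (fun _ => by norm_num) hpos₁) z) bd‖ ≤ (j₀ + α) * K * M) ∧
      (∀ (z : BondL2K ℂ d m c₁ W) (M : ℝ), 0 ≤ M → (∀ c', ‖WL2.equiv ℂ (fun _ : Bond d m => c₁) W z c'‖ ≤ M) →
        ∀ p : Bond d (towerP L m (n + 1)) × Fin d,
          ‖covGrad ((η : ℂ))⁻¹ (adTransportW φ (fun _ : Bond d (towerP L m (n + 1)) => (1 : 𝔸ˣ)))
              (WL2.equiv ℂ (fun _ : Bond d (towerP L m (n + 1)) => c₀) W
                ((H1LatticeK hposπ hQ -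
                  H1k L m n φ η (fun _ : Bond d (towerP L m (n + 1)) => (1 : 𝔸ˣ)) hL (fun _ => 0) (fun _ => by norm_num)
                (perCfg_UlevOf_one_mem_U1 L m (n + 1)) (norm_Wcx_UlevOf_one_sub_one_le L m (n + 1) (fun _ => 0) (fun _ => le_rfl)) τ (c₀ := c₀) (c₁ := c₁)
                (fun _ => by norm_num) hpos₁) z)) p‖ ≤ (j₀ + α) * K * M) := by
  classical
  obtain ⟨αV, jV, KV, κV, hαV, hjV, hKV, hκV, HV⟩ :=
    exists_letter_H1kPi_sub_flat hd L hL hL3 φ hMφ hMφ' hφ hφ' hstar ha ha' hϱ0 hϱ1 τ hτ hCτ hτm hMτ hρw hτ₁ hτ₂ hφτ AQ b hM₂ hrepr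
  obtain ⟨αG, jG, KG, κG, hαG, hjG, hKG, hκG, HG⟩ :=
    exists_gradLetter_H1kPi_sub_flat hd L hL hL3 φ hMφ hMφ' hφ hφ' hstar ha ha' hϱ0 hϱ1 τ hτ hCτ hτm hMτ hρw hτ₁ hτ₂ hφτ AQ b hM₂ hrepr
  set SV : ℝ := latticeConst d κV with hSV
  set SG : ℝ := latticeConst d κG with hSG
  have hSV0 : 0 ≤ SV := latticeConst_nonneg d hκV.le
  have hSG0 : 0 ≤ SG := latticeConst_nonneg d hκG.le
  refine ⟨min αV αG, min jV jG, KV * SV + KG * SG, lt_min hαV hαG, lt_min hjV hjG, by positivity, ?_⟩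
  intro n η hηL c₀ c₁ _ _ hw hρ m _ hm U αU hα0 hα1 hαL hU1 hreg εU hεU hε1 hUε hLb α hα hαle hUst hUb hUη hUw hpl hUgrad hRlev hεg hAQ hpos' hpos hc₀η j₀ hJ hj
    hposπ hQ hpos'₁ hpos₁
  have hαV' : α ≤ αV := hαle.trans (min_le_left _ _)
  have hαG' : α ≤ αG := hαle.trans (min_le_right _ _)
  have hjV' : j₀ ≤ jV := hj.trans (min_le_left _ _)
  have hjG' : j₀ ≤ jG := hj.trans (min_le_right _ _)
  have hj₀ : 0 ≤ j₀ := (norm_nonneg _).trans (hJ ⟨0, hd⟩ fun _ => 0)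
  -- names
  set piS : TSite d (towerP L m (n + 1)) → TSite d m := fun x => blockCoord (L ^ (n + 1)) m (siteCast (towerP_eq_fineP_pow L m (n + 1)) x) with hpiS
  set HU := H1LatticeK hposπ hQ with hHU
  set H1 := H1k L m n φ η (fun _ : Bond d (towerP L m (n + 1)) => (1 : 𝔸ˣ)) hL (fun _ => 0) (fun _ => by norm_num)
                (perCfg_UlevOf_one_mem_U1 L m (n + 1)) (norm_Wcx_UlevOf_one_sub_one_le L m (n + 1) (fun _ => 0) (fun _ => le_rfl)) τ (c₀ := c₀) (c₁ := c₁)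
                (fun _ => by norm_num) hpos₁ with hH1
  -- the block decomposition of the source over the coarse base points
  obtain ⟨P, hP⟩ := exists_block_clm_family (𝕜 := ℂ) (w := fun _ : Bond d m => c₁) (V := W) (fun c' : Bond d m => bpos c')
  have hdec : ∀ z : BondL2K ℂ d m c₁ W, (HU - H1) z = ∑ v, (HU (P v z) - H1 (P v z)) := fun z => by
    conv_lhs => rw [← sum_block_apply hP z]
    rw [LinearMap.sub_apply, map_sum, map_sum, Finset.sum_sub_distrib]
  have hfun : ∀ z : BondL2K ℂ d m c₁ W, WL2.equiv ℂ (fun _ : Bond d (towerP L m (n + 1)) => c₀) W ((HU - H1) z) =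
      ∑ v, WL2.equiv ℂ (fun _ : Bond d (towerP L m (n + 1)) => c₀) W (HU (P v z) - H1 (P v z)) := fun z => by
    rw [hdec]
    have e := map_sum (WL2.linearEquiv ℂ ℂ (fun _ : Bond d (towerP L m (n + 1)) => c₀) (V := W)) (fun v => HU (P v z) - H1 (P v z)) Finset.univ
    simpa only [WL2.linearEquiv_apply] using e
  have hblk : ∀ (z : BondL2K ℂ d m c₁ W) (M : ℝ), 0 ≤ M → (∀ c', ‖WL2.equiv ℂ (fun _ : Bond d m => c₁) W z c'‖ ≤ M) → ∀ v,
      (∀ c', bpos c' ≠ v → WL2.equiv ℂ (fun _ : Bond d m => c₁) W (P v z) c' = 0) ∧ (∀ c', ‖WL2.equiv ℂ (fun _ : Bond d m => c₁) W (P v z) c'‖ ≤ M) := by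
    intro z M hM hzM v
    refine ⟨fun c' hc' => ?_, fun c' => ?_⟩
    · rw [hP, if_neg hc']
    · rw [hP]
      split_ifs
      · exact hzM c'
      · rw [norm_zero]; exact hM
  refine ⟨fun z M hM hzM bd => ?_, fun z M hM hzM p => ?_⟩
  · -- the value row
    rw [hfun, Finset.sum_apply]
    calc ‖∑ v, WL2.equiv ℂ (fun _ : Bond d (towerP L m (n + 1)) => c₀) W (HU (P v z) - H1 (P v z)) bd‖
        ≤ ∑ v, ‖WL2.equiv ℂ (fun _ : Bond d (towerP L m (n + 1)) => c₀) W (HU (P v z) - H1 (P v z)) bd‖ := norm_sum_le _ _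
      _ ≤ ∑ v, (j₀ + α) * KV * Real.exp (-(κV * tdist m (piS (bpos bd)) v)) * M := Finset.sum_le_sum fun v _ =>
          HV n η hηL c₀ c₁ hw hρ m hm U αU hα0 hα1 hαL hU1 hreg εU hεU hε1 hUε hLb α hα hαV' hUst hUb hUη hUw hpl hUgrad hRlev hεg hAQ hpos' hpos hc₀η j₀ hJ hjV'
            hposπ hQ hpos'₁ hpos₁ v (P v z) M (hblk z M hM hzM v).1 (hblk z M hM hzM v).2 bd
      _ = (j₀ + α) * KV * M * ∑ v, Real.exp (-(κV * tdist m (piS (bpos bd)) v)) := by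
          rw [Finset.mul_sum]; exact Finset.sum_congr rfl fun v _ => by ring
      _ ≤ (j₀ + α) * KV * M * SV := mul_le_mul_of_nonneg_left (torusSum_le d hm hκV (piS (bpos bd))) (by positivity)
      _ ≤ (j₀ + α) * (KV * SV + KG * SG) * M := by nlinarith [mul_nonneg (mul_nonneg hKG hSG0) (mul_nonneg (add_nonneg hj₀ hα) hM)]
  · -- the flat-gradient row
    obtain ⟨bd, μ⟩ := p
    rw [hfun, map_sum, Finset.sum_apply]
    calc ‖∑ v, covGrad ((η : ℂ))⁻¹ (adTransportW φ (fun _ : Bond d (towerP L m (n + 1)) => (1 : 𝔸ˣ)))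
            (WL2.equiv ℂ (fun _ : Bond d (towerP L m (n + 1)) => c₀) W (HU (P v z) - H1 (P v z))) (bd, μ)‖
        ≤ ∑ v, ‖covGrad ((η : ℂ))⁻¹ (adTransportW φ (fun _ : Bond d (towerP L m (n + 1)) => (1 : 𝔸ˣ)))
            (WL2.equiv ℂ (fun _ : Bond d (towerP L m (n + 1)) => c₀) W (HU (P v z) - H1 (P v z))) (bd, μ)‖ := norm_sum_le _ _
      _ ≤ ∑ v, (j₀ + α) * KG * Real.exp (-(κG * tdist m (piS (btgt bd)) v)) * M := Finset.sum_le_sum fun v _ =>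
          HG n η hηL c₀ c₁ hw hρ m hm U αU hα0 hα1 hαL hU1 hreg εU hεU hε1 hUε hLb α hα hαG' hUst hUb hUη hUw hpl hUgrad hRlev hεg hAQ hpos' hpos hc₀η j₀ hJ hjG'
            hposπ hQ hpos'₁ hpos₁ v (P v z) M (hblk z M hM hzM v).1 (hblk z M hM hzM v).2 μ bd
      _ = (j₀ + α) * KG * M * ∑ v, Real.exp (-(κG * tdist m (piS (btgt bd)) v)) := by
          rw [Finset.mul_sum]; exact Finset.sum_congr rfl fun v _ => by ring
      _ ≤ (j₀ + α) * KG * M * SG := mul_le_mul_of_nonneg_left (torusSum_le d hm hκG (piS (btgt bd))) (by positivity)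
      _ ≤ (j₀ + α) * (KV * SV + KG * SG) * M := by nlinarith [mul_nonneg (mul_nonneg hKV hSV0) (mul_nonneg (add_nonneg hj₀ hα) hM)]

end Literature.MathematicalPhysics.QuantumFieldTheory.Balaban1983to89.B9Eq3133H1kPiTwoBackgroundSupRowsTower

end
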